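import Summits.Schanuel.Schanuel.Theorems.DiophantineDichotomyApproximationPropertyCycleAPIAt3Defs
import Summits.Schanuel.Schanuel.Theorems.DiophantineDichotomyApproximationPropertyCycleAPIAt3OrbitFloorCounting
import Summits.Schanuel.Schanuel.Theorems.DiophantineDichotomyApproximationPropertyCycleAPIAt3OrbitFloorLever
import Summits.Schanuel.Schanuel.Theorems.DiophantineDichotomyApproximationPropertyCycleAPIAt3OrbitFloorSum
import HarnessLib

/-!
# Stub `stub_orbitFloor : OrbitFloor` (stub plan `CycleAPIAt3` P2; crux `ApproximationProperty`, stmt-Schanuel-6117)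

Crux `stmt-Schanuel-6117` (`Summit.Schanuel.Schanuel.Theses.DiophantineDichotomy.ApproximationProperty`),
route `DiophantineDichotomy`, line `orbit-interpolation-determinant` (skeleton v10 of lead c4,
`Cruxes/ApproximationProperty/Lines/orbit_interpolation_determinant.lean`). This file PROVES the
stub-plan target `stub_orbitFloor : OrbitFloor` (registered name of skeleton v10; vocabulary
`…CycleAPIAt3Defs.lean`, p121319; `OrbitFloor` is the hypothesis of the landed
`pointDatum_of_lineSatellite3`, p126020, and of the registered glue `satelliteRestart_of`,
`satelliteRestart_one_of`, `CycleAPIAt3_of`) together with its weakening `orbitFloorLog`, the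
registered stub of skeleton v12 (lead c5), follows at once (file `…CycleAPIAt3OrbitFloorLog.lean`).
Statement: for every `ω ∈ ℂ³` there is `C = C(ω) > 0` such that a prime
orbit `𝔭` (rank `1`, `D = deg 𝔭`, `h = h(𝔭)`) lying on a `ℚ`-curve `V(𝔮)` (`𝔮 ≤ 𝔭` prime of rank
`2`, `δₛ = deg 𝔮`), all of whose points are at projective distance `≥ e^{−L}` (`L ≥ 1`) from
`ω̄ = (1 : ω)`, has
`log(1/|𝔭(ω̄)|) ≤ C (δₛ L + h + D log(D+2) + √(D (h + D + δₛ log(D+2)) L))` — no `D² log D` term.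

Proof (the stub plan's P2 with k2's coordinate chart, made log-free by the CLEAN lever):
1. dictionary (D) (`exp_mul_prod_projDist_le_iabs`): `log(1/|𝔭(ω̄)|) ≤ c_Z D + ∑_σ f(σ)`,
   `f(σ) = log(1/‖ω̄ − σb̄‖) ≤ L`;
2. chart at `x₀` (`PhilipponMain.affine_near_of_projDist_le`): `‖ω̄ − σb̄‖ ≤ e^{−a}`,
   `a ≥ log(2Θ)`, puts `σ(b_j/b_0)` within `2Θ² e^{−a}` of `ω_j` (`Θ = |ω̄|`);
3. fibre bound (`OrbitFloor.exists_chart_finrank_le`, Prop. 4.11 twice): some `y = b_j/b_0` has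
   `[K : ℚ(y)] ≤ δₛ`;
4. cluster count (`OrbitFloor.card_cluster_le`: primitive integer minimal polynomial of `y`,
   `log M = deg · h_K(y)/D`, the landed `cleanClusterLever`):
   `#{σ : a ≤ f(σ)} ≤ δₛ + √(16 D (h + (log 4) D + δₛ log(D+2))/a)` for `a ≥ κ(ω) + 16 log(D+2)`;
5. layer cake (`OrbitFloor.sum_le_of_count_le`): `∑ f ≤ D a₁ + 6 δₛ L + 8 √(B L)`.

Sources: the stub plan `STUB-PLAN-CycleAPIAt3.md` §3 P2 (k1 H3 ⊕ k2 H2/H3 ⊕ critic);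
NesterenkoPhilippon2001 (LNM 1752) Ch. 3 §4; Laurent–Roy 1999 (the `t = 1` discriminant device);
Bugeaud 2004 Lemma A.8.
-/

noncomputable section

-- `Summit.Schanuel.Schanuel.…` is the mandated summit/sub-problem namespace (single-conjunct summit), hence:
set_option linter.dupNamespace false

namespace Summit.Schanuel.Schanuel.Cruxes.ApproximationProperty.OrbitInterpolationDeterminant

open Literature.NumberTheory.Transcendental Literature.NumberTheory.Transcendental.Nesterenko
open Literature.NumberTheory.Transcendental.PhilipponMain MvPolynomial Real
open scoped BigOperators IntermediateField

namespace OrbitFloor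

/-- The height of a coordinate ratio is at most the height of the point:
`h_K(b_j / b_i) = h_K(b_j : b_i) ≤ h_K(b̄)`. [folklore] -/
theorem logHeight₁_div_le {K : Type*} [Field K] [NumberField K] {n : ℕ} (b : Fin n → K)
    (i j : Fin n) : Height.logHeight₁ (b j / b i) ≤ Height.logHeight b := by
  rw [Height.logHeight₁_div_eq_logHeight]
  have e : (![b j, b i] : Fin 2 → K) = b ∘ (![j, i] : Fin 2 → Fin n) := by
    ext k; fin_cases k <;> rfl
  rw [e]
  exact Height.logHeight_comp_le _ _

/-- Final bookkeeping of the orbit floor: with `c_Z, κ ≥ 0`, `D ≥ 1`, `h, L, δ ≥ 0`,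
`c_Z D + D (κ + 16 log(D+2)) + 6 δ L + 8 √(16 D (h + log 4 · D + δ log(D+2)) L)
 ≤ (c_Z + κ + 86) (δ L + h + D log(D+2) + √(D (h + D + δ log(D+2)) L))`. [folklore] -/
theorem final_arith {cZ κ D h L δ : ℝ} (hcZ : 0 ≤ cZ) (hκ : 0 ≤ κ) (hD : 1 ≤ D) (hh : 0 ≤ h)
    (hL : 0 ≤ L) (hδ : 0 ≤ δ) :
    cZ * D + D * (κ + 16 * Real.log (D + 2)) + 6 * δ * L +
        8 * Real.sqrt (16 * D * (h + Real.log 4 * D + δ * Real.log (D + 2)) * L) ≤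
      (cZ + κ + 86) * (δ * L + h + D * Real.log (D + 2) +
        Real.sqrt (D * (h + D + δ * Real.log (D + 2)) * L)) := by
  have hlog3 : 1 ≤ Real.log (D + 2) := by
    rw [Real.le_log_iff_exp_le (by linarith)]
    have := Real.exp_one_lt_d9
    linarith
  have hlog4 : Real.log 4 ≤ 4 := by
    have h := Real.log_le_sub_one_of_pos (by norm_num : (0 : ℝ) < 4)
    linarith
  have hlog40 : 0 ≤ Real.log 4 := Real.log_nonneg (by norm_num)
  have hlogD0 : 0 ≤ Real.log (D + 2) := by linarith
  have hD0 : 0 ≤ D := by linarith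
  set S := Real.sqrt (D * (h + D + δ * Real.log (D + 2)) * L) with hS
  have hS0 : 0 ≤ S := Real.sqrt_nonneg _
  set X := D * Real.log (D + 2) with hX
  have hDX : D ≤ X := le_mul_of_one_le_right hD0 hlog3
  have hX0 : 0 ≤ X := hD0.trans hDX
  have hδL : 0 ≤ δ * L := mul_nonneg hδ hL
  set T := δ * L + h + X + S with hT
  have hXT : X ≤ T := by rw [hT]; linarith
  have hDT : D ≤ T := hDX.trans hXT
  have hST : S ≤ T := by rw [hT]; linarith
  have hδLT : δ * L ≤ T := by rw [hT]; linarith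
  -- the square root term: radicand ≤ 64 · (the target radicand)
  have hsqrt : Real.sqrt (16 * D * (h + Real.log 4 * D + δ * Real.log (D + 2)) * L) ≤ 8 * S := by
    have hin : 16 * D * (h + Real.log 4 * D + δ * Real.log (D + 2)) * L ≤
        64 * (D * (h + D + δ * Real.log (D + 2)) * L) := by
      have h1 : h + Real.log 4 * D + δ * Real.log (D + 2) ≤ 4 * (h + D + δ * Real.log (D + 2)) := by
        have : 0 ≤ δ * Real.log (D + 2) := mul_nonneg hδ hlogD0
        nlinarith
      have hDL : 0 ≤ D * L := by positivity
      nlinarith [mul_le_mul_of_nonneg_left h1 hDL]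
    calc Real.sqrt (16 * D * (h + Real.log 4 * D + δ * Real.log (D + 2)) * L)
        ≤ Real.sqrt (64 * (D * (h + D + δ * Real.log (D + 2)) * L)) := Real.sqrt_le_sqrt hin
      _ = 8 * S := by
          rw [Real.sqrt_mul' 64 (by positivity), show (64 : ℝ) = 8 ^ 2 by norm_num,
            Real.sqrt_sq (by norm_num)]
  -- term by term
  have t1 : cZ * D ≤ cZ * T := mul_le_mul_of_nonneg_left hDT hcZ
  have t2 : D * (κ + 16 * Real.log (D + 2)) = κ * D + 16 * X := by rw [hX]; ring
  have t3 : κ * D ≤ κ * T := mul_le_mul_of_nonneg_left hDT hκ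
  have t4 : 8 * Real.sqrt (16 * D * (h + Real.log 4 * D + δ * Real.log (D + 2)) * L) ≤ 64 * T := by
    linarith
  have e : (cZ + κ + 86) * (δ * L + h + D * Real.log (D + 2) + S) =
      cZ * T + κ * T + 86 * T := by
    rw [hT, hX]; ring
  rw [e, t2]
  have hhT : 0 ≤ T := hX0.trans hXT
  linarith

/-- Bookkeeping of the counting bound: `max(e, √(16(e D l_D + D h_y)/a)) ≤ δ + √(16 D (h + l₄ D + δ l_D)/a)`
when `0 ≤ e ≤ δ`, `h_y ≤ h + l₄ D`. [folklore] -/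
theorem count_arith {e δ D hy hgt a l4 lD : ℝ} (he0 : 0 ≤ e) (heδ : e ≤ δ) (hD : 0 ≤ D)
    (hhy : hy ≤ hgt + l4 * D) (hlD : 0 ≤ lD) (ha : 0 < a) :
    max e (Real.sqrt (16 * (e * D * lD + D * hy) / a)) ≤
      δ + Real.sqrt (16 * D * (hgt + l4 * D + δ * lD) / a) := by
  have hsq0 : 0 ≤ Real.sqrt (16 * D * (hgt + l4 * D + δ * lD) / a) := Real.sqrt_nonneg _
  have hδ0 : 0 ≤ δ := he0.trans heδ
  refine max_le (by linarith) ?_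
  refine le_trans (Real.sqrt_le_sqrt ?_) (by linarith)
  refine div_le_div_of_nonneg_right ?_ ha.le
  have hDl : 0 ≤ D * lD := mul_nonneg hD hlD
  have h1 : e * D * lD ≤ δ * D * lD := by nlinarith
  have h2 : D * hy ≤ D * (hgt + l4 * D) := mul_le_mul_of_nonneg_left hhy hD
  nlinarith

end OrbitFloor

open OrbitFloor in
/-- **Stub `stub_orbitFloor : OrbitFloor` (stub plan P2, registered name `stub_orbitFloor`)** — the
ORBIT FLOOR: for every `ω ∈ ℂ³` there is `C > 0` such that a prime orbit `𝔭` of rank `1` lying on a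
`ℚ`-curve `V(𝔮)` (`𝔮 ≤ 𝔭` prime of rank `2`), all of whose points are at projective distance
`≥ e^{−L}` (`L ≥ 1`) from `ω̄ = (1 : ω)`, satisfies
`log(1/|𝔭(ω̄)|) ≤ C (deg 𝔮 · L + h(𝔭) + deg 𝔭 log(deg 𝔭 + 2) + √(deg 𝔭 (h(𝔭) + deg 𝔭 + deg 𝔮 log(deg 𝔭 + 2)) L))`
(dictionary (D) + coordinate chart + fibre bound + clean cluster lever + layer cake; no `D² log D`).
[cite: NesterenkoPhilippon2001, Ch. 3 §4 (Prop. 4.4, 4.7, 4.11)] -/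
theorem stub_orbitFloor : OrbitFloor := by
  intro ω
  classical
  -- constants depending on `ω` only
  set ω₁ : Fin (3 + 1) → ℂ := Fin.cons 1 ω with hω₁
  set Θ : ℝ := ‖ω₁‖ with hΘ
  have hΘ1 : 1 ≤ Θ := one_le_norm_cons_one ω
  have hω₁0 : ω₁ ≠ 0 := cons_one_ne_zero ω
  set cZ : ℝ := (Fintype.card (Fin 1 × SkewIdx 3) : ℝ) + Real.log ((3 : ℕ) + 1) with hcZ
  have hcZ0 : 0 ≤ cZ :=
    add_nonneg (Nat.cast_nonneg _) (Real.log_nonneg (by norm_num))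
  set ρ : ℝ := 2 * Θ ^ 2 with hρ
  have hρ1 : 1 ≤ ρ := by rw [hρ]; nlinarith only [hΘ1]
  have hΘρ : 2 * Θ ≤ 2 * ρ := by rw [hρ]; nlinarith only [hΘ1]
  set κ : ℝ := 28 + 4 * Real.log (2 * ρ) with hκ
  have hlog2ρ : 0 ≤ Real.log (2 * ρ) := Real.log_nonneg (by linarith only [hρ1])
  have hκ0 : 0 ≤ κ := by rw [hκ]; linarith only [hlog2ρ]
  refine ⟨cZ + κ + 86, by linarith only [hcZ0, hκ0], ?_⟩
  intro 𝔭 𝔮 L h𝔭 h𝔭hom h𝔭unm h𝔮 h𝔮hom h𝔮unm hle hL hfar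
  -- §0 the normalised zero and its field
  obtain ⟨β₀, hβ₀⟩ := projZeros_nonempty' h𝔭 h𝔭hom h𝔭unm
  obtain ⟨j, hj0⟩ := Function.ne_iff.mp hβ₀.1
  have hb' : (β₀ j)⁻¹ • β₀ ∈ projZeros 𝔭 :=
    smul_mem_projZeros (fun P hP k => homogeneousComponent_mem_of_mem h𝔭hom hP k) hβ₀
      (inv_ne_zero hj0)
  have hj : ((β₀ j)⁻¹ • β₀) j = 1 := by
    rw [Pi.smul_apply, smul_eq_mul, inv_mul_cancel₀ hj0]
  haveI := numberField_adjoin h𝔭 h𝔭hom h𝔭unm hb' hj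
  set K : IntermediateField ℚ ℂ := IntermediateField.adjoin ℚ (Set.range ((β₀ j)⁻¹ • β₀)) with hK
  let b : Fin (3 + 1) → K := fun k =>
    ⟨((β₀ j)⁻¹ • β₀) k, IntermediateField.subset_adjoin ℚ _ ⟨k, rfl⟩⟩
  have hb : ∀ k, (b k : ℂ) = ((β₀ j)⁻¹ • β₀) k := fun k => rfl
  have hA : ∀ β : Fin (3 + 1) → ℂ,
      β ∈ projZeros 𝔭 ↔ β ≠ 0 ∧ ∃ (σ : K →+* ℂ) (l : ℂ), β = fun k => l * σ (b k) :=
    mem_projZeros_iff h𝔭 h𝔭hom h𝔭unm hb' hj hb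
  have hBinj : ∀ (σ τ : K →+* ℂ) (l : ℂ),
      ((fun k => σ (b k)) = fun k => l * τ (b k)) → σ = τ :=
    embedding_eq_of_proportional hj hb
  have hdegK : Module.finrank ℚ K = ideg 𝔭 1 := finrank_eq_ideg h𝔭 h𝔭hom h𝔭unm hb' hj hb
  have hheight : Height.logHeight b ≤ iheight 𝔭 1 + Real.log ((3 : ℕ) + 1) * ideg 𝔭 1 :=
    logHeight_le h𝔭 h𝔭hom h𝔭unm hb' hj hb
  have hvalue := exp_mul_prod_projDist_le_iabs h𝔭 h𝔭hom h𝔭unm hb' hj hb hω₁0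
  have hbj : b j = 1 := Subtype.ext (by rw [hb, hj]; rfl)
  -- abbreviations
  set D : ℕ := ideg 𝔭 1 with hDdef
  set δ : ℕ := ideg 𝔮 2 with hδdef
  set hgt : ℝ := iheight 𝔭 1 with hhgt
  have hDpos : 0 < D := by rw [← hdegK]; exact Module.finrank_pos
  have hD1 : (1 : ℝ) ≤ D := by exact_mod_cast hDpos
  have hD0 : (0 : ℝ) ≤ D := Nat.cast_nonneg _
  have hhgt0 : 0 ≤ hgt := height_nonneg _
  have hδ0 : (0 : ℝ) ≤ δ := Nat.cast_nonneg _
  have hcardE : Fintype.card (K →+* ℂ) = D := by rw [NumberField.Embeddings.card K ℂ, hdegK]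
  -- every conjugate is a zero, hence far from `ω̄`
  have hconj : ∀ σ : K →+* ℂ, (fun k => σ (b k)) ∈ projZeros 𝔭 := by
    intro σ
    refine (hA _).mpr ⟨?_, σ, 1, funext fun k => by rw [one_mul]⟩
    intro h0
    have h1 := congrFun h0 j
    rw [hbj, map_one] at h1
    exact one_ne_zero h1
  have hfarσ : ∀ σ : K →+* ℂ, Real.exp (-L) ≤ projDist ω₁ (fun k => σ (b k)) :=
    fun σ => hfar _ (hconj σ)
  have hdpos : ∀ σ : K →+* ℂ, 0 < projDist ω₁ (fun k => σ (b k)) :=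
    fun σ => lt_of_lt_of_le (Real.exp_pos _) (hfarσ σ)
  -- §1 dictionary (D): `log(1/|𝔭(ω̄)|) ≤ c_Z D + ∑ f`
  set f : (K →+* ℂ) → ℝ := fun σ => -Real.log (projDist ω₁ (fun k => σ (b k))) with hf
  have hsumf : ∑ σ, f σ = -∑ σ : K →+* ℂ, Real.log (projDist ω₁ (fun k => σ (b k))) := by
    rw [← Finset.sum_neg_distrib]
  have hprod : 0 < ∏ σ : K →+* ℂ, projDist ω₁ (fun k => σ (b k)) :=
    Finset.prod_pos fun σ _ => hdpos σ
  have hiabs : 0 < iabs 𝔭 1 ω₁ := lt_of_lt_of_le (mul_pos (Real.exp_pos _) hprod) hvalue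
  have hstep1 : Real.log (1 / iabs 𝔭 1 ω₁) ≤ cZ * D + ∑ σ, f σ := by
    have h1 := Real.log_le_log (mul_pos (Real.exp_pos _) hprod) hvalue
    rw [Real.log_mul (Real.exp_pos _).ne' hprod.ne', Real.log_exp,
      Real.log_prod (fun σ _ => (hdpos σ).ne')] at h1
    rw [one_div, Real.log_inv, hsumf]
    have e : ((Fintype.card (Fin 1 × SkewIdx 3) : ℝ) + Real.log ((3 : ℕ) + 1)) * (D : ℝ) =
        cZ * D := by rw [hcZ]
    linarith only [h1, e]
  clear hvalue hprod
  -- §2 `f ≤ L`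
  have hfL : ∀ σ, f σ ≤ L := by
    intro σ
    have h1 := Real.log_le_log (Real.exp_pos _) (hfarσ σ)
    rw [Real.log_exp] at h1
    rw [hf]
    simp only
    linarith only [h1]
  -- §3 the counting bound
  set a₁ : ℝ := κ + 16 * Real.log ((D : ℝ) + 2) with ha₁
  have hlogD2 : 0 ≤ Real.log ((D : ℝ) + 2) := Real.log_nonneg (by linarith only [hD1])
  have ha₁pos : 0 < a₁ := by rw [ha₁, hκ]; linarith only [hlog2ρ, hlogD2]
  set B : ℝ := 16 * D * (hgt + Real.log 4 * D + δ * Real.log ((D : ℝ) + 2)) with hBdef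
  have hlog40 : 0 ≤ Real.log 4 := Real.log_nonneg (by norm_num)
  have hB0 : 0 ≤ B := by rw [hBdef]; positivity
  have hhgt4 : Height.logHeight b ≤ hgt + Real.log 4 * D := by
    have e : Real.log ((3 : ℕ) + 1) = Real.log 4 := by norm_num
    rw [e] at hheight
    exact hheight
  have hcount : ∀ a : ℝ, a₁ ≤ a →
      ((Finset.univ.filter fun σ => a ≤ f σ).card : ℝ) ≤ δ + Real.sqrt (B / a) := by
    intro a ha
    have ha0 : 0 < a := lt_of_lt_of_le ha₁pos ha
    have hsq0 : 0 ≤ Real.sqrt (B / a) := Real.sqrt_nonneg _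
    -- `a > log(2Θ)`: a zero with `a ≤ f σ` is `e^{-a}`-close, in the chart `x₀`
    have hlog2Θ : Real.log (2 * Θ) < a := by
      have h1 : Real.log (2 * Θ) ≤ Real.log (2 * ρ) :=
        Real.log_le_log (by linarith only [hΘ1]) hΘρ
      rw [ha₁, hκ] at ha
      linarith only [ha, h1, hlogD2, hlog2ρ]
    have hclose : ∀ σ, a ≤ f σ → projDist ω₁ (fun k => σ (b k)) ≤ Real.exp (-a) := by
      intro σ hσ
      rw [hf] at hσ
      simp only at hσ
      have h1 : Real.log (projDist ω₁ (fun k => σ (b k))) ≤ -a := by linarith only [hσ]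
      calc projDist ω₁ (fun k => σ (b k))
          = Real.exp (Real.log (projDist ω₁ (fun k => σ (b k)))) := (Real.exp_log (hdpos σ)).symm
        _ ≤ Real.exp (-a) := Real.exp_le_exp.mpr h1
    have hhalf : Real.exp (-a) * Θ ≤ 1 / 2 := by
      have h1 : Real.exp (-a) < Real.exp (-Real.log (2 * Θ)) :=
        Real.exp_lt_exp.mpr (by linarith only [hlog2Θ])
      rw [Real.exp_neg (Real.log _), Real.exp_log (by linarith only [hΘ1])] at h1
      have h2 : Real.exp (-a) * Θ ≤ (2 * Θ)⁻¹ * Θ :=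
        mul_le_mul_of_nonneg_right h1.le (by linarith only [hΘ1])
      have h3 : (2 * Θ)⁻¹ * Θ = 1 / 2 := by
        have hΘ0 : Θ ≠ 0 := by
          intro h0; rw [h0] at hΘ1; exact absurd hΘ1 (by norm_num)
        field_simp
      rw [h3] at h2
      exact h2
    have hchart : ∀ σ : K →+* ℂ, a ≤ f σ →
        projDist ω₁ (fun k => σ (b k)) * ‖ω₁‖ ≤ 1 / 2 := fun σ hσ =>
      le_trans (mul_le_mul_of_nonneg_right (hclose σ hσ) (norm_nonneg _)) hhalf
    -- case `b 0 = 0`: no zero is that close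
    by_cases hb0 : b 0 = 0
    · have hempty : (Finset.univ.filter fun σ => a ≤ f σ) = ∅ := by
        refine Finset.filter_eq_empty_iff.mpr fun σ _ hσ => ?_
        have h0 := (affine_near_of_projDist_le ω (hconj σ).1 (hchart σ hσ)).1
        exact h0 (by rw [hb0, map_zero])
      rw [hempty, Finset.card_empty, Nat.cast_zero]
      positivity
    -- the chart: some `y = b_j / b_0` with `[K : ℚ(y)] ≤ δ`
    obtain ⟨jc, hjc⟩ := exists_chart_finrank_le (by norm_num : 2 ≤ 3) h𝔮 h𝔮hom h𝔮unm hle b hA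
      hBinj hdegK hb0
    set y : K := b jc / b 0 with hy
    have heδ : (Module.finrank ℚ⟮y⟯ K : ℝ) ≤ δ := by rw [hδdef]; exact_mod_cast hjc
    have hcardle : ((Finset.univ.filter fun σ => a ≤ f σ).card : ℝ) ≤ D := by
      rw [← hcardE]
      exact_mod_cast Finset.card_le_univ _
    -- sub-case `jc = 0`: `y = 1`, `[K : ℚ] ≤ δ`
    by_cases hjc0 : jc = 0
    · have hy1 : y = 1 := by rw [hy, hjc0, div_self hb0]
      have hbot : ℚ⟮y⟯ = ⊥ := by
        rw [hy1]
        exact IntermediateField.adjoin_simple_eq_bot_iff.mpr (one_mem _)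
      have heD : Module.finrank ℚ⟮y⟯ K = Module.finrank ℚ K := by
        rw [hbot]
        exact IntermediateField.finrank_bot'
      have hDδ : (D : ℝ) ≤ δ := by
        rw [← hdegK, ← heD]; exact heδ
      exact (hcardle.trans hDδ).trans (le_add_of_nonneg_right hsq0)
    -- sub-case `jc = j'.succ`: the cluster count
    obtain ⟨j', rfl⟩ := Fin.exists_succ_eq.mpr hjc0
    have hsub : (Finset.univ.filter fun σ => a ≤ f σ) ⊆
        Finset.univ.filter fun σ : K →+* ℂ => ‖σ y - ω j'‖ ≤ ρ * Real.exp (-a) := by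
      intro σ hσ
      rw [Finset.mem_filter] at hσ ⊢
      refine ⟨hσ.1, ?_⟩
      have hd := hclose σ hσ.2
      have h3 := (affine_near_of_projDist_le ω (hconj σ).1 (hchart σ hσ.2)).2.2 j'
      have hσy : σ y = σ (b j'.succ) / σ (b 0) := by rw [hy, map_div₀]
      rw [hσy]
      calc ‖σ (b j'.succ) / σ (b 0) - ω j'‖
          ≤ 2 * ‖ω₁‖ ^ 2 * projDist ω₁ (fun k => σ (b k)) := h3
        _ ≤ 2 * ‖ω₁‖ ^ 2 * Real.exp (-a) := mul_le_mul_of_nonneg_left hd (by positivity)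
        _ = ρ * Real.exp (-a) := by rw [hρ]
    have haK : 28 + 4 * Real.log (2 * ρ) + 16 * Real.log (Module.finrank ℚ K + 2) ≤ a := by
      rw [hdegK]; rw [ha₁, hκ] at ha; exact ha
    have hcl := card_cluster_le K y (ω j') hρ1 haK
    rw [hdegK] at hcl
    have hhy : Height.logHeight₁ y ≤ hgt + Real.log 4 * D :=
      (logHeight₁_div_le b 0 j'.succ).trans hhgt4
    have hmax := count_arith (e := (Module.finrank ℚ⟮y⟯ K : ℝ)) (Nat.cast_nonneg _) heδ hD0 hhy
      hlogD2 ha0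
    calc ((Finset.univ.filter fun σ => a ≤ f σ).card : ℝ)
        ≤ ((Finset.univ.filter fun σ : K →+* ℂ => ‖σ y - ω j'‖ ≤ ρ * Real.exp (-a)).card : ℝ) := by
          exact_mod_cast Finset.card_le_card hsub
      _ ≤ _ := hcl
      _ ≤ _ := hmax
  -- §4 layer cake
  have hL0 : 0 < L := by linarith only [hL]
  have hsum := sum_le_of_count_le f ha₁pos hδ0 hB0 hL0 hfL hcount
  rw [hcardE] at hsum
  -- §5 assemble
  have hfin := final_arith (h := hgt) (L := L) (δ := (δ : ℝ)) hcZ0 hκ0 hD1 hhgt0 hL0.le hδ0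
  have e1 : (D : ℝ) * a₁ = D * (κ + 16 * Real.log ((D : ℝ) + 2)) := by rw [ha₁]
  have e2 : Real.sqrt (B * L) =
      Real.sqrt (16 * D * (hgt + Real.log 4 * D + δ * Real.log ((D : ℝ) + 2)) * L) := by
    rw [hBdef]
  rw [e1, e2] at hsum
  linarith only [hstep1, hsum, hfin]

end Summit.Schanuel.Schanuel.Cruxes.ApproximationProperty.OrbitInterpolationDeterminant

end
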